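import Summits.CriticalPhenomena.Ising3DConformalLimit.Theorems.MirrorHoelderCompactnessTwoPointDoublingGreenComparisonCore
import Literature.Probability.LatticeModels.CriticalAxisRatioRegularity
import HarnessLib

/-!
# Stub `stub_greenComparison` of line `superharmonic-comparison` — crux `TwoPointDoubling` (stmt-CriticalPhenomena-6150)

**The discrete comparison principle: no positive effective mass ⟹ all-scale doubling.**
If `ΔG(x) ≤ A·G(x)/‖x‖²` for every `x ≠ 0` (`G = criticalTwoPoint 3`, six-neighbour lattice Laplacian, sup norm),
then `∃ κ > 0, ∀ n ≥ 1, κ·g(n) ≤ g(2n)` for the axis profile `g(n) = G(n e₀)` — the body of the crux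
`TwoPointDoubling` (item stmt-CriticalPhenomena-6150; Aizenman–Duminil-Copin 2021, Remark 5.10), i.e. the registered
stub `stub_greenComparison` of the strategist line `Cruxes/TwoPointDoubling/Lines/superharmonic_comparison.lean`
proved BY NAME AND SIGNATURE.  The comparison step at the scales `3k` is `doubling_three_mul_of_kato`
(companion file `…TwoPointDoublingGreenComparisonCore.lean`: minimum principle for `Δ − A⁺/‖x‖²` on the box
`{k < x₀ < 8k, |x₁|, |x₂| < k}` against the exact lattice eigenfunction `sinh(μ(8k − x₀)) cos(πx₁/2k) cos(πx₂/2k)`,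
MMS sandwich on the near face); here log-convexity of the axis profile (`criticalTwoPoint_axis_ratio_mono`: one-step
ratios `g(m+1)/g(m) ≥ r := g(2)/g(1) ∈ (0,1]`) and monotonicity (`criticalTwoPoint_axis_antitone`) interpolate to
every `n ≥ 1`, with `κ = (sinh 2c / sinh 7c)·r³`, `c = √(π²/2 + max A 0 + 1)`.

With `stub_dlrLaplacian` this makes `OneSidedKatoBound ⟹ TwoPointDoubling` an importable funnel edge of a new kind
for item 6150 (a LOCAL one-sided input, not an axis-profile fact: the barrier
`Literature.Barriers.CriticalPhenomena.AxisProfileAxiomaticsNoDoubling` does not apply — its lacunary witnesses have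
`ΔY·‖x‖²/Y → ∞` on their massive episodes).  Landed from the lead seat of crux stmt-CriticalPhenomena-1981 (line
`folded-current-repulsion`, whose registered stub F2 `stub_wallRepulsion` IS item 6150).

References: M. Aizenman, H. Duminil-Copin, Ann. of Math. 194 (2021), arXiv:1912.07973, Remark 5.10 and §5.5–5.6
[AizenmanDuminilCopinAnnals2021]; A. Messager, S. Miracle-Solé, J. Stat. Phys. 17 (1977) [MessagerMiracleSoleJSP1977].
-/

noncomputable section

open Real Finset
open scoped BigOperators
open Literature.Probability.LatticeModels

namespace Summit.CriticalPhenomena.Ising3DConformalLimit.Cruxes.TwoPointDoubling.SuperharmonicComparison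


/-! ## Axis facts of the critical two-point function -/

/-- One-step ratio bound on the critical axis: `r·g(m) ≤ g(m+1)` for `m ≥ 1` with `r = g(2)/g(1) ∈ (0,1]`
(log-convexity `criticalTwoPoint_axis_ratio_mono` and monotonicity). [cite: AizenmanDuminilCopinAnnals2021, arXiv:1912.07973 §5.5 proof of Prop. 5.9] -/
theorem axis_ratio_lower_greenComparison : ∃ r : ℝ, 0 < r ∧ r ≤ 1 ∧ ∀ m : ℕ, 1 ≤ m →
    r * criticalTwoPoint 3 (Pi.single 0 (m : ℤ)) ≤ criticalTwoPoint 3 (Pi.single 0 ((m + 1 : ℕ) : ℤ)) := by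
  have hpos : ∀ m : ℕ, 0 < criticalTwoPoint 3 (Pi.single 0 (m : ℤ)) := criticalTwoPoint_axis_pos
  have h21 : criticalTwoPoint 3 (Pi.single 0 ((2 : ℕ) : ℤ)) ≤ criticalTwoPoint 3 (Pi.single 0 ((1 : ℕ) : ℤ)) :=
    criticalTwoPoint_axis_antitone (by norm_num : (1 : ℕ) ≤ 2)
  refine ⟨criticalTwoPoint 3 (Pi.single 0 ((2 : ℕ) : ℤ)) / criticalTwoPoint 3 (Pi.single 0 ((1 : ℕ) : ℤ)),
    div_pos (hpos 2) (hpos 1), (div_le_one (hpos 1)).2 h21, fun m hm => ?_⟩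
  have hmono := criticalTwoPoint_axis_ratio_mono 0 (Nat.zero_le (m - 1))
  simp only [zero_add, Nat.sub_add_cancel hm, show m - 1 + 2 = m + 1 by omega] at hmono
  rw [div_le_div_iff₀ (hpos 1) (hpos m)] at hmono
  rw [div_mul_eq_mul_div, div_le_iff₀ (hpos 1)]
  linarith

/-- Iterating the one-step ratio bound: `r^j · g(m) ≤ g(m+j)` for `m ≥ 1`. [folklore] -/
theorem axis_ratio_iter_greenComparison {r : ℝ} (hr : 0 < r)
    (hstep : ∀ m : ℕ, 1 ≤ m → r * criticalTwoPoint 3 (Pi.single 0 (m : ℤ)) ≤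
      criticalTwoPoint 3 (Pi.single 0 ((m + 1 : ℕ) : ℤ))) :
    ∀ j m : ℕ, 1 ≤ m → r ^ j * criticalTwoPoint 3 (Pi.single 0 (m : ℤ)) ≤
      criticalTwoPoint 3 (Pi.single 0 ((m + j : ℕ) : ℤ)) := by
  intro j
  induction j with
  | zero => intro m _; simp
  | succ j ih =>
    intro m hm
    have h1 := ih m hm
    have h2 := hstep (m + j) (by omega)
    rw [show m + (j + 1) = m + j + 1 by omega]
    calc r ^ (j + 1) * criticalTwoPoint 3 (Pi.single 0 (m : ℤ))
        = r * (r ^ j * criticalTwoPoint 3 (Pi.single 0 (m : ℤ))) := by ring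
      _ ≤ r * criticalTwoPoint 3 (Pi.single 0 ((m + j : ℕ) : ℤ)) := mul_le_mul_of_nonneg_left h1 hr.le
      _ ≤ criticalTwoPoint 3 (Pi.single 0 ((m + j + 1 : ℕ) : ℤ)) := h2

/-! ## The registered stub -/

/-- **STUB 3 · `stub_greenComparison` — the comparison principle: no positive effective mass ⟹ doubling.**
If `ΔG(x) ≤ A·G(x)/‖x‖²` for all `x ≠ 0` (`G = criticalTwoPoint 3`, six-neighbour lattice Laplacian, sup norm on
`ℤ³`) then `∃ κ > 0, ∀ n ≥ 1, κ g(n) ≤ g(2n)` for the axis profile `g(n) = G(n e₀)` — the body of the crux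
`TwoPointDoubling` (item stmt-CriticalPhenomena-6150). Comparison at the scales `3k` (`doubling_three_mul_of_kato`)
plus log-convex interpolation (`axis_ratio_lower_greenComparison`, `criticalTwoPoint_axis_antitone`).
[cite: AizenmanDuminilCopinAnnals2021, arXiv:1912.07973 Remark 5.10 and §5.6] [cite: MessagerMiracleSoleJSP1977, main theorem] -/
theorem stub_greenComparison :
    (∃ A : ℝ, ∀ x : Literature.Probability.LatticeModels.Site 3, x ≠ 0 →
      (∑ i : Fin 3, (Literature.Probability.LatticeModels.criticalTwoPoint 3 (x + Pi.single i 1) +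
          Literature.Probability.LatticeModels.criticalTwoPoint 3 (x - Pi.single i 1))) -
        6 * Literature.Probability.LatticeModels.criticalTwoPoint 3 x ≤
        A * Literature.Probability.LatticeModels.criticalTwoPoint 3 x / ‖x‖ ^ 2) →
    ∃ κ : ℝ, 0 < κ ∧ ∀ n : ℕ, 1 ≤ n →
      κ * Literature.Probability.LatticeModels.criticalTwoPoint 3 (Pi.single 0 (n : ℤ)) ≤
        Literature.Probability.LatticeModels.criticalTwoPoint 3 (Pi.single 0 (2 * (n : ℤ))) := by
  rintro ⟨A, hA⟩
  set c : ℝ := Real.sqrt (π ^ 2 / 2 + max A 0 + 1) with hcdef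
  have hcpos : 0 < c := Real.sqrt_pos.2 (by positivity)
  set κ₀ : ℝ := Real.sinh (2 * c) / Real.sinh (7 * c) with hκ₀def
  have h7 : 0 < Real.sinh (7 * c) := Real.sinh_pos_iff.2 (by positivity)
  have hκ₀pos : 0 < κ₀ := div_pos (Real.sinh_pos_iff.2 (by positivity)) h7
  obtain ⟨r, hr, hr1, hstep⟩ := axis_ratio_lower_greenComparison
  have hiter := axis_ratio_iter_greenComparison hr hstep
  refine ⟨κ₀ * r ^ 3, by positivity, fun n hn => ?_⟩
  -- the scale k with 3k ∈ [n, n+3] and 6k ≥ 2n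
  obtain ⟨k, hk1, hk2, hk3⟩ : ∃ k : ℕ, 1 ≤ k ∧ n ≤ 3 * k ∧ 3 * k ≤ n + 3 := ⟨n / 3 + 1, by omega, by omega, by omega⟩
  have e1 : criticalTwoPoint 3 (Pi.single 0 ((6 * k : ℕ) : ℤ)) ≤ criticalTwoPoint 3 (Pi.single 0 (2 * (n : ℤ))) := by
    have := criticalTwoPoint_axis_antitone (show 2 * n ≤ 6 * k by omega)
    have e : (Pi.single 0 (2 * (n : ℤ)) : Site 3) = Pi.single 0 (((2 * n : ℕ) : ℤ)) := by push_cast; rfl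
    rw [e]
    exact this
  have e2 : κ₀ * criticalTwoPoint 3 (Pi.single 0 ((3 * k : ℕ) : ℤ)) ≤ criticalTwoPoint 3 (Pi.single 0 ((6 * k : ℕ) : ℤ)) :=
    doubling_three_mul_of_kato hA hk1
  have e3 : r ^ (3 * k - n) * criticalTwoPoint 3 (Pi.single 0 (n : ℤ)) ≤
      criticalTwoPoint 3 (Pi.single 0 ((3 * k : ℕ) : ℤ)) := by
    have := hiter (3 * k - n) n hn
    rwa [show n + (3 * k - n) = 3 * k by omega] at this
  have e4 : r ^ 3 ≤ r ^ (3 * k - n) := pow_le_pow_of_le_one hr.le hr1 (by omega)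
  have hgn : 0 < criticalTwoPoint 3 (Pi.single 0 (n : ℤ)) := criticalTwoPoint_axis_pos n
  calc κ₀ * r ^ 3 * criticalTwoPoint 3 (Pi.single 0 (n : ℤ))
      ≤ κ₀ * (r ^ (3 * k - n) * criticalTwoPoint 3 (Pi.single 0 (n : ℤ))) := by
        rw [mul_assoc]
        exact mul_le_mul_of_nonneg_left (mul_le_mul_of_nonneg_right e4 hgn.le) hκ₀pos.le
    _ ≤ κ₀ * criticalTwoPoint 3 (Pi.single 0 ((3 * k : ℕ) : ℤ)) := mul_le_mul_of_nonneg_left e3 hκ₀pos.le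
    _ ≤ criticalTwoPoint 3 (Pi.single 0 ((6 * k : ℕ) : ℤ)) := e2
    _ ≤ criticalTwoPoint 3 (Pi.single 0 (2 * (n : ℤ))) := e1

end Summit.CriticalPhenomena.Ising3DConformalLimit.Cruxes.TwoPointDoubling.SuperharmonicComparison

end
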